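import Summits.AtomisticToContinuum.Crystallization.Theorems.ChartedZeroExcessLayeredLatticeLiouvilleXE

/-!
# Zero-excess layered lattice Liouville — part XF (lens-2 g59, node «SBGlueC1»): THE ENERGY DICTIONARY between bond energies on `S` and index energies

Critic rows 1051/1119 (ORDER OF RECORD for `stmt-AtomisticToContinuum-26636`): leaf (2) `SubWindowBudgetGlueBPG` via SBGlueA–D; XC = A (scalar core), XD + XE =
B (transport foundations).  Part C1 (this file; memo NODE-g59a-SBGlueB-Design.md §4 (C1)) is the ENERGY half of the index ↔ space dictionary: the SB-glue
recursion runs on the index energies `idxEnergy φ_j (idxBall X₀ n)` of the pulled-back fields, while the column's [SBᵇ] and (I4ˢ) speak of `bondEnergy (S ∩ ball x ρ)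
(p ↦ p − Ψ p)`.  All PROVED; no statement of the column is re-typed.

* XF.1 THE CALCULUS OF `bondEnergy` (the tree had none): finite-sum forms (`bondEnergy_eq_sum₂`, `bondEnergy_eq_sum` over the bond-pair finset `bondPairs`),
  `bondEnergy_nonneg`, `bondEnergy_mono` (in the chunk), `bondEnergy_congr`, `bondEnergy_add_le` / `bondEnergy_sub_le` (the parallelogram bound `2·+2·`),
  the bond count `card_bondFibre_le` / `card_bondPairs_le` (`δ`-separation: `≤ (10/δ+1)³` bonds per atom) and `bondEnergy_le_of_bond_le`.
* XF.2 INDEX RADIUS OF A EUCLIDEAN BALL: along an `S`-bond chain the index `I = lsite⁻¹ ∘ Ψ` moves by `≤ D/c` per bond (`4 ↦ D` tear-free, co-Lipschitz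
  `c`), so `S ∩ ball x r` is indexed inside `idxBall (I x) ((2r+8)·D/c)` (`dist_idxOf_le_of_mem_ball`, XD.2's long chains in the `1`-clean `S`); also
  `atomOf_idxOf_apply`, `idxOf_transReg`, `transReg_self_apply`.
* XF.3 ★★ DIRECTION A `bondEnergy_comp_idxOf_le`: for a field read through the index, `bondEnergy Q (f ∘ I) ≤ dictA c D · idxEnergy f (idxBall X₀ n)` whenever
  `I '' Q ⊆ idxBall X₀ n` — a `4`-bond of `Q ⊆ S` becomes an index displacement `u` of sup-norm `≤ D/c ≤ 2⌈D/2c⌉`, the bond energy is re-indexed INJECTIVELY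
  into the localised translate increments `dispSqOn` of part VA, and each of the `(4⌈D/2c⌉+1)³` increments is `≤ 36⌈D/2c⌉²·idxEnergy` by part VB's three-leg
  telescoping (`dispSqOn_le_of_idxNorm_le`) — no multiplicity counting needed.  ★ `bondEnergy_disp_transReg_le`: the case `f = pullDisp S Ψ_j …`, `f ∘ I = id − Ψ_j`
  for EVERY transported registration `Ψ_j = transReg Ψ …` (the index map `I` never changes, XF.2 `idxOf_transReg`).
* XF.4 CHART DRIFT COSTS `μ²`: if `lsite' − lsite` is `μ`-index-Lipschitz then `bondEnergy Q (Ψ' − Ψ) ≤ (μD/c)²(10/δ+1)³·nK Q` (`bondEnergy_transReg_sub_le`), whence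
  the BUDGET TRANSFER between the original and the transported displacement in both directions (`bondEnergy_disp_le_of_transReg`, `bondEnergy_disp_transReg_le_of_disp`)
  — the `2ê_j + 2μ_j²` of the memo's budget closing.
-/

noncomputable section

open scoped BigOperators InnerProductSpace RealInnerProductSpace
open Set Function Metric
open Summit.AtomisticToContinuum.Crystallization.Theorems.ChartedPlanarOrderRigidityDoor (E3 IsClean)
open Summit.AtomisticToContinuum.Crystallization.Theorems.ChartedPlanarOrderDensityDichotomy (μS IsSep nK)
open Summit.AtomisticToContinuum.Crystallization.Theorems.ChartedPlanarOrderCleanScaleP (IsCleanP isCleanP_one_iff)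
open Summit.AtomisticToContinuum.Crystallization.Theorems.ChartedPlanarOrderDoorLayered (Layered)

namespace Summit.AtomisticToContinuum.Crystallization.Theorems.ChartedZeroExcessLayeredLatticeLiouville

/-! ### XF.1  The calculus of `bondEnergy` on finite chunks -/

/-- the `4`-bond fibre of `x` in a finite chunk: the sites `p` of the chunk with `dist p x ≤ 4`. [this file, g59] -/
def bondFibre {Q : Set E3} (hQ : Q.Finite) (x : E3) : Finset E3 :=
  hQ.toFinset.filter fun p => dist p x ≤ 4

/-- the finset of `4`-BOND PAIRS `(x, p)`, `dist p x ≤ 4`, of a finite chunk. [this file, g59] -/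
def bondPairs {Q : Set E3} (hQ : Q.Finite) : Finset (E3 × E3) :=
  (hQ.toFinset ×ˢ hQ.toFinset).filter fun x => dist x.2 x.1 ≤ 4

/-- Auxiliary step (`mem bondFibre`). [formal bookkeeping] -/
theorem mem_bondFibre {Q : Set E3} (hQ : Q.Finite) {x p : E3} : p ∈ bondFibre hQ x ↔ p ∈ Q ∧ dist p x ≤ 4 := by
  unfold bondFibre
  rw [Finset.mem_filter, Set.Finite.mem_toFinset]

/-- Auxiliary step (`mem bondPairs`). [formal bookkeeping] -/
theorem mem_bondPairs {Q : Set E3} (hQ : Q.Finite) {x : E3 × E3} : x ∈ bondPairs hQ ↔ x.1 ∈ Q ∧ x.2 ∈ Q ∧ dist x.2 x.1 ≤ 4 := by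
  unfold bondPairs
  rw [Finset.mem_filter, Finset.mem_product, Set.Finite.mem_toFinset, Set.Finite.mem_toFinset, and_assoc]

/-- `bondEnergy` of a finite chunk as a DOUBLE finite sum (centres, then bond fibres). [this file, g59] -/
theorem bondEnergy_eq_sum₂ {Q : Set E3} (hQ : Q.Finite) (φ : E3 → E3) :
    bondEnergy Q φ = ∑ x ∈ hQ.toFinset, ∑ p ∈ bondFibre hQ x, ‖φ p - φ x‖ ^ 2 := by
  unfold bondEnergy
  rw [finsum_mem_eq_finite_toFinset_sum _ hQ]
  refine Finset.sum_congr rfl fun x _ => ?_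
  rw [finsum_mem_eq_finite_toFinset_sum _ (hQ.inter_of_left (closedBall x 4))]
  refine Finset.sum_congr ?_ fun _ _ => rfl
  ext p
  rw [Set.Finite.mem_toFinset, mem_bondFibre, mem_inter_iff, mem_closedBall]

/-- `bondEnergy` of a finite chunk as ONE finite sum over its bond pairs. [this file, g59] -/
theorem bondEnergy_eq_sum {Q : Set E3} (hQ : Q.Finite) (φ : E3 → E3) :
    bondEnergy Q φ = ∑ x ∈ bondPairs hQ, ‖φ x.2 - φ x.1‖ ^ 2 := by
  rw [bondEnergy_eq_sum₂ hQ, bondPairs, Finset.sum_filter, Finset.sum_product]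
  refine Finset.sum_congr rfl fun x _ => ?_
  rw [bondFibre, Finset.sum_filter]

/-- Auxiliary step (`bondEnergy nonneg`). [formal bookkeeping] -/
theorem bondEnergy_nonneg (Q : Set E3) (φ : E3 → E3) : 0 ≤ bondEnergy Q φ :=
  finsum_nonneg fun _ => finsum_nonneg fun _ => finsum_nonneg fun _ => finsum_nonneg fun _ => sq_nonneg _

/-- `bondEnergy` is MONOTONE in the (finite) chunk. [this file, g59] -/
theorem bondEnergy_mono {Q Q' : Set E3} (hQ' : Q'.Finite) (h : Q ⊆ Q') (φ : E3 → E3) : bondEnergy Q φ ≤ bondEnergy Q' φ := by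
  rw [bondEnergy_eq_sum (hQ'.subset h), bondEnergy_eq_sum hQ']
  refine Finset.sum_le_sum_of_subset_of_nonneg (fun x hx => ?_) fun _ _ _ => sq_nonneg _
  rw [mem_bondPairs] at hx ⊢
  exact ⟨h hx.1, h hx.2.1, hx.2.2⟩

/-- `bondEnergy` only sees the field on the chunk. [formal bookkeeping] -/
theorem bondEnergy_congr {Q : Set E3} {φ ψ : E3 → E3} (h : ∀ p ∈ Q, φ p = ψ p) : bondEnergy Q φ = bondEnergy Q ψ :=
  finsum_mem_congr rfl fun x hx => finsum_mem_congr rfl fun p hp => by rw [h x hx, h p hp.1]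

/-- the parallelogram bound for sums of fields. [this file, g59] -/
theorem bondEnergy_add_le {Q : Set E3} (hQ : Q.Finite) (φ ψ : E3 → E3) :
    bondEnergy Q (fun p => φ p + ψ p) ≤ 2 * bondEnergy Q φ + 2 * bondEnergy Q ψ := by
  rw [bondEnergy_eq_sum hQ, bondEnergy_eq_sum hQ, bondEnergy_eq_sum hQ, Finset.mul_sum, Finset.mul_sum, ← Finset.sum_add_distrib]
  refine Finset.sum_le_sum fun x _ => ?_
  have e : φ x.2 + ψ x.2 - (φ x.1 + ψ x.1) = (φ x.2 - φ x.1) + (ψ x.2 - ψ x.1) := by abel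
  rw [e]
  exact norm_add_sq_le_two _ _

/-- the parallelogram bound for differences of fields. [this file, g59] -/
theorem bondEnergy_sub_le {Q : Set E3} (hQ : Q.Finite) (φ ψ : E3 → E3) :
    bondEnergy Q (fun p => φ p - ψ p) ≤ 2 * bondEnergy Q φ + 2 * bondEnergy Q ψ := by
  have h := bondEnergy_add_le hQ φ (fun p => -(ψ p))
  have e : bondEnergy Q (fun p => -(ψ p)) = bondEnergy Q ψ := by
    rw [bondEnergy_eq_sum hQ, bondEnergy_eq_sum hQ]
    refine Finset.sum_congr rfl fun x _ => ?_
    show ‖-(ψ x.2) - -(ψ x.1)‖ ^ 2 = ‖ψ x.2 - ψ x.1‖ ^ 2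
    rw [neg_sub_neg, norm_sub_rev]
  rw [e] at h
  have e2 : bondEnergy Q (fun p => φ p - ψ p) = bondEnergy Q (fun p => φ p + -(ψ p)) := bondEnergy_congr fun p _ => sub_eq_add_neg _ _
  rw [e2]
  exact h

/-- BONDS PER ATOM: in a `δ`-separated configuration every `4`-bond fibre has `≤ (10/δ+1)³` sites. [this file, g59] -/
theorem card_bondFibre_le {δ : ℝ} (hδ : 0 < δ) {S Q : Set E3} (hsep : IsSep δ S) (hQS : Q ⊆ S) (hQ : Q.Finite) (x : E3) :
    ((bondFibre hQ x).card : ℝ) ≤ (10 / δ + 1) ^ 3 := by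
  have hfin : (S ∩ ball x 5).Finite := finite_inter_ball_of_isSep hδ hsep x 5
  have hsub : bondFibre hQ x ⊆ hfin.toFinset := fun p hp => by
    rw [mem_bondFibre] at hp
    rw [Set.Finite.mem_toFinset]
    exact ⟨hQS hp.1, mem_ball.2 (by linarith [hp.2])⟩
  have h1 : ((bondFibre hQ x).card : ℝ) ≤ ((S ∩ ball x 5).ncard : ℝ) := by
    rw [Set.ncard_eq_toFinset_card _ hfin]
    exact_mod_cast Finset.card_le_card hsub
  have h2 := ncard_inter_ball_le_packing hδ hsep x (show (0 : ℝ) ≤ 5 by norm_num)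
  have e : (2 * 5 / δ + 1) = (10 / δ + 1) := by ring
  rw [e] at h2
  exact h1.trans h2

/-- Auxiliary step (`nK eq card toFinset`). [formal bookkeeping] -/
theorem nK_eq_card_toFinset {Q : Set E3} (hQ : Q.Finite) : nK Q = (hQ.toFinset.card : ℝ) := by
  unfold nK
  rw [Set.ncard_eq_toFinset_card _ hQ]

/-- BOND COUNT: a finite chunk of a `δ`-separated configuration has `≤ (10/δ+1)³·nK Q` bond pairs. [this file, g59] -/
theorem card_bondPairs_le {δ : ℝ} (hδ : 0 < δ) {S Q : Set E3} (hsep : IsSep δ S) (hQS : Q ⊆ S) (hQ : Q.Finite) :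
    ((bondPairs hQ).card : ℝ) ≤ (10 / δ + 1) ^ 3 * nK Q := by
  have h1 : ((bondPairs hQ).card : ℝ) = ∑ x ∈ hQ.toFinset, ((bondFibre hQ x).card : ℝ) := by
    have e : (bondPairs hQ).card = ∑ x ∈ hQ.toFinset, (bondFibre hQ x).card := by
      rw [bondPairs, Finset.card_filter, Finset.sum_product]
      refine Finset.sum_congr rfl fun x _ => ?_
      rw [bondFibre, Finset.card_filter]
    rw [e]
    push_cast
    rfl
  rw [h1, nK_eq_card_toFinset hQ]
  calc ∑ x ∈ hQ.toFinset, ((bondFibre hQ x).card : ℝ) ≤ ∑ x ∈ hQ.toFinset, (10 / δ + 1) ^ 3 :=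
        Finset.sum_le_sum fun x _ => card_bondFibre_le hδ hsep hQS hQ x
    _ = (10 / δ + 1) ^ 3 * (hQ.toFinset.card : ℝ) := by rw [Finset.sum_const, nsmul_eq_mul, mul_comm]

/-- a UNIFORM bound on the bond terms bounds the bond energy by `M·(10/δ+1)³·nK Q`. [this file, g59] -/
theorem bondEnergy_le_of_bond_le {δ : ℝ} (hδ : 0 < δ) {S Q : Set E3} (hsep : IsSep δ S) (hQS : Q ⊆ S) (hQ : Q.Finite) {φ : E3 → E3} {M : ℝ}
    (hM : 0 ≤ M) (h : ∀ x ∈ Q, ∀ p ∈ Q, dist p x ≤ 4 → ‖φ p - φ x‖ ^ 2 ≤ M) :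
    bondEnergy Q φ ≤ M * ((10 / δ + 1) ^ 3 * nK Q) := by
  rw [bondEnergy_eq_sum hQ]
  calc ∑ x ∈ bondPairs hQ, ‖φ x.2 - φ x.1‖ ^ 2 ≤ ∑ x ∈ bondPairs hQ, M := Finset.sum_le_sum fun x hx => by
          obtain ⟨h1, h2, h3⟩ := (mem_bondPairs hQ).1 hx
          exact h _ h1 _ h2 h3
    _ = ((bondPairs hQ).card : ℝ) * M := by rw [Finset.sum_const, nsmul_eq_mul]
    _ ≤ (10 / δ + 1) ^ 3 * nK Q * M := mul_le_mul_of_nonneg_right (card_bondPairs_le hδ hsep hQS hQ) hM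
    _ = M * ((10 / δ + 1) ^ 3 * nK Q) := by ring

/-- a PROFILE DOMINATION `‖φ p − φ x‖ ≤ τ x` on bonds bounds the bond energy by `(10/δ+1)³·Σ_Q τ²`. [this file, g59] -/
theorem bondEnergy_le_of_dominated {δ : ℝ} (hδ : 0 < δ) {S Q : Set E3} (hsep : IsSep δ S) (hQS : Q ⊆ S) (hQ : Q.Finite) {φ : E3 → E3} {τ : E3 → ℝ}
    (h : ∀ x ∈ Q, ∀ p ∈ Q, dist p x ≤ 4 → ‖φ p - φ x‖ ≤ τ x) :
    bondEnergy Q φ ≤ (10 / δ + 1) ^ 3 * ∑ᶠ x ∈ Q, τ x ^ 2 := by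
  rw [bondEnergy_eq_sum₂ hQ, finsum_mem_eq_finite_toFinset_sum _ hQ, Finset.mul_sum]
  refine Finset.sum_le_sum fun x hx => ?_
  have hxQ : x ∈ Q := (Set.Finite.mem_toFinset hQ).1 hx
  calc ∑ p ∈ bondFibre hQ x, ‖φ p - φ x‖ ^ 2 ≤ ∑ p ∈ bondFibre hQ x, τ x ^ 2 := Finset.sum_le_sum fun p hp => by
          obtain ⟨hpQ, hd⟩ := (mem_bondFibre hQ).1 hp
          have h1 := h x hxQ p hpQ hd
          exact pow_le_pow_left₀ (norm_nonneg _) h1 2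
    _ = ((bondFibre hQ x).card : ℝ) * τ x ^ 2 := by rw [Finset.sum_const, nsmul_eq_mul]
    _ ≤ (10 / δ + 1) ^ 3 * τ x ^ 2 := mul_le_mul_of_nonneg_right (card_bondFibre_le hδ hsep hQS hQ x) (sq_nonneg _)

/-! ### XF.2  Index distance along bond chains; the index radius of a Euclidean ball -/

/-- telescoping along a chain in any pseudo-metric space. [folklore] -/
theorem dist_chain_le {α : Type*} [PseudoMetricSpace α] (F : ℕ → α) {L : ℝ} {k : ℕ} (h : ∀ i, i < k → dist (F (i + 1)) (F i) ≤ L) :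
    dist (F k) (F 0) ≤ (k : ℝ) * L := by
  induction k with
  | zero => simp
  | succ k ih =>
    calc dist (F (k + 1)) (F 0) ≤ dist (F (k + 1)) (F k) + dist (F k) (F 0) := dist_triangle _ _ _
      _ ≤ L + (k : ℝ) * L := add_le_add (h k (Nat.lt_succ_self k)) (ih fun i hi => h i (Nat.lt_succ_of_lt hi))
      _ = ((k + 1 : ℕ) : ℝ) * L := by push_cast; ring

section Dictionary

variable {S : Set E3} {Ψ : E3 → E3} {a b a' b' : E3} {w w' : ℤ → E3} {c c' : ℝ}

/-- the atom at the index of an atom is the atom. [formal bookkeeping] -/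
theorem atomOf_idxOf_apply (hbij : BijOn Ψ S (Layered a b w)) {p : E3} (hp : p ∈ S) : atomOf S Ψ a b w (idxOf a b w (Ψ p)) = p := by
  unfold atomOf
  rw [lsite_idxOf_apply hbij hp]
  exact hbij.invOn_invFunOn.1 hp

/-- ★ THE INDEX MAP NEVER CHANGES: the transported registration indexes every atom exactly as the original one. [this file, g59] -/
theorem idxOf_transReg (hc' : 0 < c') (hcr' : IsLayeredCrystal c' a' b' w') (p : E3) :
    idxOf a' b' w' (transReg Ψ a b w a' b' w' p) = idxOf a b w (Ψ p) :=
  idxOf_lsite hc' hcr' _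

/-- transporting to the same chart gives back the registration (on `S`). [formal bookkeeping] -/
theorem transReg_self_apply (hbij : BijOn Ψ S (Layered a b w)) {p : E3} (hp : p ∈ S) : transReg Ψ a b w a b w p = Ψ p :=
  lsite_idxOf_apply hbij hp

/-- index distance grows by `≤ D/c` per bond of an `S`-chain (`4 ↦ D` tear-free registration into a `c`-co-Lipschitz crystal). [this file, g59] -/
theorem dist_idxOf_le_of_isBondChain (hbij : BijOn Ψ S (Layered a b w)) (hc : 0 < c) (hcr : IsLayeredCrystal c a b w) {D : ℝ}
    (h4D : ∀ x ∈ S, ∀ p ∈ S, dist p x ≤ 4 → dist (Ψ p) (Ψ x) ≤ D) {x p : E3} {k : ℕ} {z : ℕ → E3} (hz : IsBondChain S x p k z) :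
    dist (idxOf a b w (Ψ p)) (idxOf a b w (Ψ x)) ≤ (k : ℝ) * (D / c) := by
  obtain ⟨h0, hk, hmem, hbond⟩ := hz
  have h := dist_chain_le (fun i => idxOf a b w (Ψ (z i))) (L := D / c) (k := k) fun i hi => by
    have hi1 : z (i + 1) ∈ S := hmem (i + 1) hi
    have hi0 : z i ∈ S := hmem i hi.le
    have hd : dist (z (i + 1)) (z i) ≤ 4 := (hbond i hi).trans (by norm_num)
    exact (dist_idxOf_le hbij hc hcr hi1 hi0).trans (div_le_div_of_nonneg_right (h4D _ hi0 _ hi1 hd) hc.le)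
  simpa only [hk, h0] using h

/-- ★ **INDEX RADIUS OF A EUCLIDEAN BALL**: in a `1`-clean `S`, an atom at distance `≤ r` from `x ∈ S` is indexed within `(2r+8)·D/c` of the index of `x`
(XD.2 long chains + `dist_idxOf_le_of_isBondChain`). [this file, g59] -/
theorem dist_idxOf_le_of_mem_ball (hS1 : IsCleanP 1 (μS S)) (hbij : BijOn Ψ S (Layered a b w)) (hc : 0 < c) (hcr : IsLayeredCrystal c a b w) {D : ℝ}
    (hD : 0 ≤ D) (h4D : ∀ x ∈ S, ∀ p ∈ S, dist p x ≤ 4 → dist (Ψ p) (Ψ x) ≤ D) {x p : E3} (hx : x ∈ S) (hp : p ∈ S) {r : ℝ} (hr : 0 ≤ r)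
    (hd : dist p x ≤ r) : dist (idxOf a b w (Ψ p)) (idxOf a b w (Ψ x)) ≤ (2 * r + 8) * (D / c) := by
  obtain ⟨k, z, hk, hz⟩ := cleanBondPath_real hS1 hp hx hr hd
  exact (dist_idxOf_le_of_isBondChain hbij hc hcr h4D hz).trans (mul_le_mul_of_nonneg_right hk (div_nonneg hD hc.le))

/-- the atoms of `S ∩ ball x r` are indexed inside `idxBall (I x) ((2r+8)·D/c)`. [this file, g59] -/
theorem idxOf_mem_idxBall_of_mem (hS1 : IsCleanP 1 (μS S)) (hbij : BijOn Ψ S (Layered a b w)) (hc : 0 < c) (hcr : IsLayeredCrystal c a b w) {D : ℝ}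
    (hD : 0 ≤ D) (h4D : ∀ x ∈ S, ∀ p ∈ S, dist p x ≤ 4 → dist (Ψ p) (Ψ x) ≤ D) {x : E3} (hx : x ∈ S) {r : ℝ} (hr : 0 ≤ r) {p : E3}
    (hp : p ∈ S ∩ ball x r) : idxOf a b w (Ψ p) ∈ idxBall (idxOf a b w (Ψ x)) ((2 * r + 8) * (D / c)) :=
  dist_idxOf_le_of_mem_ball hS1 hbij hc hcr hD h4D hx hp.1 hr (mem_ball.1 hp.2).le

/-! ### XF.3  Direction A of the energy dictionary -/

/-- the Direction-A dictionary constant `36·(4R₀+1)³·R₀²`, `R₀ = ⌈D/2c⌉`. [this file, g59] -/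
def dictA (c D : ℝ) : ℝ := 36 * (4 * (⌈D / (2 * c)⌉₊ : ℝ) + 1) ^ 3 * (⌈D / (2 * c)⌉₊ : ℝ) ^ 2

/-- Auxiliary step (`dictA nonneg`). [formal bookkeeping] -/
theorem dictA_nonneg (c D : ℝ) : 0 ≤ dictA c D := by unfold dictA; positivity

/-- the index map `lsite⁻¹ ∘ Ψ` is injective on `S`. [formal bookkeeping] -/
theorem injOn_idxOf_comp (hbij : BijOn Ψ S (Layered a b w)) : InjOn (fun p => idxOf a b w (Ψ p)) S := fun p hp q hq h => by
  have h' := congrArg (fun X : Cell 2 × ℤ => lsite a b w X.1 X.2) h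
  simp only [lsite_idxOf_apply hbij hp, lsite_idxOf_apply hbij hq] at h'
  exact hbij.injOn hp hq h'

/-- ★★ **DIRECTION A OF THE ENERGY DICTIONARY**: a field READ THROUGH THE INDEX has bond energy on a chunk `Q ⊆ S` at most `dictA c D` times the index energy
on any index ball containing `I '' Q` (re-indexing the bonds injectively into VA's translate increments; VB's three-leg bound per increment). [this file, g59] -/
theorem bondEnergy_comp_idxOf_le (hbij : BijOn Ψ S (Layered a b w)) (hc : 0 < c) (hcr : IsLayeredCrystal c a b w) {D : ℝ}
    (h4D : ∀ x ∈ S, ∀ p ∈ S, dist p x ≤ 4 → dist (Ψ p) (Ψ x) ≤ D) {Q : Set E3} (hQS : Q ⊆ S) (hQ : Q.Finite)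
    {X₀ : Cell 2 × ℤ} {n : ℝ} (hQB : ∀ p ∈ Q, idxOf a b w (Ψ p) ∈ idxBall X₀ n) (f : Cell 2 → ℤ → E3) {g : E3 → E3}
    (hg : ∀ p ∈ Q, g p = f (idxOf a b w (Ψ p)).1 (idxOf a b w (Ψ p)).2) :
    bondEnergy Q g ≤ dictA c D * idxEnergy f (idxBall X₀ n) := by
  set R₀ : ℕ := ⌈D / (2 * c)⌉₊ with hR₀
  set I : E3 → Cell 2 × ℤ := fun p => idxOf a b w (Ψ p) with hI
  set B : Finset (Cell 2 × ℤ) := idxBallF X₀ n with hB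
  have hIB : ∀ p ∈ Q, I p ∈ B := fun p hp => by rw [hB, mem_idxBallF]; exact hQB p hp
  have hIinj : InjOn I S := injOn_idxOf_comp hbij
  set T : E3 × E3 → (Cell 2 × ℤ) × (Cell 2 × ℤ) := fun x => (I x.2 - I x.1, I x.1) with hT
  have hTinj : InjOn T ↑(bondPairs hQ) := by
    intro x hx y hy h
    obtain ⟨hx1, hx2, -⟩ := (mem_bondPairs hQ).1 hx
    obtain ⟨hy1, hy2, -⟩ := (mem_bondPairs hQ).1 hy
    have h2 : I x.1 = I y.1 := congrArg Prod.snd h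
    have h1 : I x.2 - I x.1 = I y.2 - I y.1 := congrArg Prod.fst h
    have h3 : I x.2 = I y.2 := by
      rw [h2] at h1
      exact sub_left_injective h1
    exact Prod.ext (hIinj (hQS hx1) (hQS hy1) h2) (hIinj (hQS hx2) (hQS hy2) h3)
  have hDc : D / c ≤ 2 * (R₀ : ℝ) := by
    have e : D / c = 2 * (D / (2 * c)) := by field_simp
    rw [e]
    exact mul_le_mul_of_nonneg_left (Nat.le_ceil _) (by norm_num)
  have hnorm : ∀ x ∈ bondPairs hQ, idxNorm (I x.2 - I x.1) ≤ 2 * R₀ := by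
    intro x hx
    obtain ⟨hx1, hx2, hd⟩ := (mem_bondPairs hQ).1 hx
    have h1 : (idxNorm (I x.2 - I x.1) : ℝ) ≤ dist (I x.1) (I x.2) := idxNorm_le_dist _ _
    have h2 : dist (I x.1) (I x.2) ≤ D / c := by
      refine (dist_idxOf_le hbij hc hcr (hQS hx1) (hQS hx2)).trans (div_le_div_of_nonneg_right ?_ hc.le)
      rw [dist_comm]
      exact h4D _ (hQS hx1) _ (hQS hx2) hd
    have h3 : (idxNorm (I x.2 - I x.1) : ℝ) ≤ ((2 * R₀ : ℕ) : ℝ) := by push_cast; linarith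
    exact_mod_cast h3
  rw [bondEnergy_eq_sum hQ]
  calc ∑ x ∈ bondPairs hQ, ‖g x.2 - g x.1‖ ^ 2
      = ∑ x ∈ bondPairs hQ, dispSqFam f (T x).1 (T x).2 := by
        refine Finset.sum_congr rfl fun x hx => ?_
        obtain ⟨hx1, hx2, -⟩ := (mem_bondPairs hQ).1 hx
        rw [hg _ hx1, hg _ hx2]
        simp only [hT, dispSqFam, add_sub_cancel, hI]
    _ = ∑ y ∈ (bondPairs hQ).image T, dispSqFam f y.1 y.2 := by rw [Finset.sum_image hTinj]
    _ = ∑ y ∈ (bondPairs hQ).image T, (if y.2 + y.1 ∈ B then dispSqFam f y.1 y.2 else 0) := by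
        refine Finset.sum_congr rfl fun y hy => ?_
        obtain ⟨x, hx, rfl⟩ := Finset.mem_image.1 hy
        obtain ⟨-, hx2, -⟩ := (mem_bondPairs hQ).1 hx
        have hm : (T x).2 + (T x).1 ∈ B := by
          simp only [hT, add_sub_cancel]
          exact hIB _ hx2
        rw [if_pos hm]
    _ ≤ ∑ y ∈ idxBox (2 * R₀) ×ˢ B, (if y.2 + y.1 ∈ B then dispSqFam f y.1 y.2 else 0) := by
        refine Finset.sum_le_sum_of_subset_of_nonneg (fun y hy => ?_) fun y _ _ => by
          split_ifs
          · exact dispSqFam_nonneg _ _ _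
          · exact le_rfl
        obtain ⟨x, hx, rfl⟩ := Finset.mem_image.1 hy
        obtain ⟨hx1, -, -⟩ := (mem_bondPairs hQ).1 hx
        exact Finset.mem_product.2 ⟨mem_idxBox (hnorm x hx), hIB _ hx1⟩
    _ = ∑ u ∈ idxBox (2 * R₀), dispSqOn B f u := by rw [Finset.sum_product]; rfl
    _ ≤ ∑ u ∈ idxBox (2 * R₀), 36 * (R₀ : ℝ) ^ 2 * idxEnergy f (idxBall X₀ n) :=
        Finset.sum_le_sum fun u hu => dispSqOn_le_of_idxNorm_le X₀ n f (idxNorm_le_of_mem_idxBox hu)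
    _ = dictA c D * idxEnergy f (idxBall X₀ n) := by
        rw [Finset.sum_const, card_idxBox, nsmul_eq_mul, dictA]
        push_cast
        ring

/-- ★ **THE TRANSPORTED DISPLACEMENT, read on `S`**: for every re-charting `(a', b', w')` of a bijective `4 ↦ D` tear-free registration `Ψ`,
`bondEnergy Q (id − Ψ') ≤ dictA c D · idxEnergy (pullDisp S Ψ' a' b' w') (idxBall X₀ n)` with `Ψ' = transReg Ψ …` and the ORIGINAL index map locating `Q`
(by XF.2 it is also `Ψ'`'s).  At `(a', b', w') = (a, b, w)` this is the original displacement (`transReg_self_apply`). [this file, g59] -/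
theorem bondEnergy_disp_transReg_le (hbij : BijOn Ψ S (Layered a b w)) (hc : 0 < c) (hcr : IsLayeredCrystal c a b w)
    (hc' : 0 < c') (hcr' : IsLayeredCrystal c' a' b' w') {D : ℝ} (h4D : ∀ x ∈ S, ∀ p ∈ S, dist p x ≤ 4 → dist (Ψ p) (Ψ x) ≤ D)
    {Q : Set E3} (hQS : Q ⊆ S) (hQ : Q.Finite) {X₀ : Cell 2 × ℤ} {n : ℝ} (hQB : ∀ p ∈ Q, idxOf a b w (Ψ p) ∈ idxBall X₀ n) :
    bondEnergy Q (fun p => p - transReg Ψ a b w a' b' w' p) ≤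
      dictA c D * idxEnergy (pullDisp S (transReg Ψ a b w a' b' w') a' b' w') (idxBall X₀ n) := by
  have hbij' := bijOn_transReg hbij hc hcr hc' hcr' (S := S) (Ψ := Ψ) (a' := a') (b' := b') (w' := w')
  refine bondEnergy_comp_idxOf_le hbij hc hcr h4D hQS hQ hQB _ fun p hp => ?_
  have e : lsite a' b' w' (idxOf a b w (Ψ p)).1 (idxOf a b w (Ψ p)).2 = transReg Ψ a b w a' b' w' p := rfl
  show p - transReg Ψ a b w a' b' w' p = invFunOn (transReg Ψ a b w a' b' w') S (lsite a' b' w' _ _) - lsite a' b' w' _ _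
  rw [e, hbij'.invOn_invFunOn.1 (hQS hp)]

/-- the ORIGINAL displacement `id − Ψ` read on `S`: `bondEnergy Q (id − Ψ) ≤ dictA c D · idxEnergy (pullDisp S Ψ a b w) (idxBall X₀ n)`. [this file, g59] -/
theorem bondEnergy_disp_le (hbij : BijOn Ψ S (Layered a b w)) (hc : 0 < c) (hcr : IsLayeredCrystal c a b w) {D : ℝ}
    (h4D : ∀ x ∈ S, ∀ p ∈ S, dist p x ≤ 4 → dist (Ψ p) (Ψ x) ≤ D) {Q : Set E3} (hQS : Q ⊆ S) (hQ : Q.Finite) {X₀ : Cell 2 × ℤ} {n : ℝ}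
    (hQB : ∀ p ∈ Q, idxOf a b w (Ψ p) ∈ idxBall X₀ n) :
    bondEnergy Q (fun p => p - Ψ p) ≤ dictA c D * idxEnergy (pullDisp S Ψ a b w) (idxBall X₀ n) := by
  refine bondEnergy_comp_idxOf_le hbij hc hcr h4D hQS hQ hQB _ fun p hp => ?_
  show p - Ψ p = invFunOn Ψ S (lsite a b w _ _) - lsite a b w _ _
  rw [lsite_idxOf_apply hbij (hQS hp), hbij.invOn_invFunOn.1 (hQS hp)]

/-! ### XF.4  Chart drift costs `μ²`: budget transfer between the original and the transported displacement -/

/-- ★ the registration difference `Ψ' − Ψ` of a `μ`-index-Lipschitz re-charting has bond energy `≤ (μD/c)²·(10/δ+1)³·nK Q`. [this file, g59] -/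
theorem bondEnergy_transReg_sub_le (hbij : BijOn Ψ S (Layered a b w)) (hc : 0 < c) (hcr : IsLayeredCrystal c a b w) {μ D δ : ℝ} (hμ : 0 ≤ μ)
    (hA : IsIdxLipschitz μ (fun γ m => lsite a' b' w' γ m - lsite a b w γ m)) (h4D : ∀ x ∈ S, ∀ p ∈ S, dist p x ≤ 4 → dist (Ψ p) (Ψ x) ≤ D)
    (hδ : 0 < δ) (hsep : IsSep δ S) {Q : Set E3} (hQS : Q ⊆ S) (hQ : Q.Finite) :
    bondEnergy Q (fun p => transReg Ψ a b w a' b' w' p - Ψ p) ≤ (μ * (D / c)) ^ 2 * ((10 / δ + 1) ^ 3 * nK Q) := by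
  refine bondEnergy_le_of_bond_le hδ hsep hQS hQ (sq_nonneg _) fun x hx p hp hd => ?_
  have hxS := hQS hx
  have hpS := hQS hp
  rw [transReg_sub_self hbij hpS, transReg_sub_self hbij hxS]
  have h1 := hA (idxOf a b w (Ψ x)) (idxOf a b w (Ψ p))
  have h2 : dist (idxOf a b w (Ψ x)) (idxOf a b w (Ψ p)) ≤ D / c := by
    refine (dist_idxOf_le hbij hc hcr hxS hpS).trans (div_le_div_of_nonneg_right ?_ hc.le)
    rw [dist_comm]
    exact h4D _ hxS _ hpS hd
  have h3 : ‖(lsite a' b' w' (idxOf a b w (Ψ p)).1 (idxOf a b w (Ψ p)).2 - lsite a b w (idxOf a b w (Ψ p)).1 (idxOf a b w (Ψ p)).2) -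
      (lsite a' b' w' (idxOf a b w (Ψ x)).1 (idxOf a b w (Ψ x)).2 - lsite a b w (idxOf a b w (Ψ x)).1 (idxOf a b w (Ψ x)).2)‖ ≤ μ * (D / c) :=
    h1.trans (mul_le_mul_of_nonneg_left h2 hμ)
  have h0 : 0 ≤ μ * (D / c) := (norm_nonneg _).trans h3
  exact pow_le_pow_left₀ (norm_nonneg _) h3 2

/-- ★ **BUDGET TRANSFER, transported → original**: `bondEnergy Q (id − Ψ) ≤ 2·bondEnergy Q (id − Ψ') + 2(μD/c)²(10/δ+1)³·nK Q` — the `2ê_j + 2μ_j²` of the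
budget closing (memo §2). [this file, g59] -/
theorem bondEnergy_disp_le_of_transReg (hbij : BijOn Ψ S (Layered a b w)) (hc : 0 < c) (hcr : IsLayeredCrystal c a b w) {μ D δ : ℝ} (hμ : 0 ≤ μ)
    (hA : IsIdxLipschitz μ (fun γ m => lsite a' b' w' γ m - lsite a b w γ m)) (h4D : ∀ x ∈ S, ∀ p ∈ S, dist p x ≤ 4 → dist (Ψ p) (Ψ x) ≤ D)
    (hδ : 0 < δ) (hsep : IsSep δ S) {Q : Set E3} (hQS : Q ⊆ S) (hQ : Q.Finite) :
    bondEnergy Q (fun p => p - Ψ p) ≤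
      2 * bondEnergy Q (fun p => p - transReg Ψ a b w a' b' w' p) + 2 * ((μ * (D / c)) ^ 2 * ((10 / δ + 1) ^ 3 * nK Q)) := by
  have e : bondEnergy Q (fun p => p - Ψ p) = bondEnergy Q (fun p => (p - transReg Ψ a b w a' b' w' p) + (transReg Ψ a b w a' b' w' p - Ψ p)) :=
    bondEnergy_congr fun p _ => by abel
  rw [e]
  refine (bondEnergy_add_le hQ _ _).trans ?_
  have h := bondEnergy_transReg_sub_le hbij hc hcr hμ hA h4D hδ hsep hQS hQ (a' := a') (b' := b') (w' := w')
  linarith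

/-- ★ **BUDGET TRANSFER, original → transported**: `bondEnergy Q (id − Ψ') ≤ 2·bondEnergy Q (id − Ψ) + 2(μD/c)²(10/δ+1)³·nK Q` (how the window data of
`IsGlobalReg` reach the iterate's (I4ˢ) budgets). [this file, g59] -/
theorem bondEnergy_disp_transReg_le_of_disp (hbij : BijOn Ψ S (Layered a b w)) (hc : 0 < c) (hcr : IsLayeredCrystal c a b w) {μ D δ : ℝ} (hμ : 0 ≤ μ)
    (hA : IsIdxLipschitz μ (fun γ m => lsite a' b' w' γ m - lsite a b w γ m)) (h4D : ∀ x ∈ S, ∀ p ∈ S, dist p x ≤ 4 → dist (Ψ p) (Ψ x) ≤ D)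
    (hδ : 0 < δ) (hsep : IsSep δ S) {Q : Set E3} (hQS : Q ⊆ S) (hQ : Q.Finite) :
    bondEnergy Q (fun p => p - transReg Ψ a b w a' b' w' p) ≤
      2 * bondEnergy Q (fun p => p - Ψ p) + 2 * ((μ * (D / c)) ^ 2 * ((10 / δ + 1) ^ 3 * nK Q)) := by
  have e : bondEnergy Q (fun p => p - transReg Ψ a b w a' b' w' p) = bondEnergy Q (fun p => (p - Ψ p) - (transReg Ψ a b w a' b' w' p - Ψ p)) :=
    bondEnergy_congr fun p _ => by abel
  rw [e]
  refine (bondEnergy_sub_le hQ _ _).trans ?_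
  have h := bondEnergy_transReg_sub_le hbij hc hcr hμ hA h4D hδ hsep hQS hQ (a' := a') (b' := b') (w' := w')
  linarith

end Dictionary

end Summit.AtomisticToContinuum.Crystallization.Theorems.ChartedZeroExcessLayeredLatticeLiouville

end
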